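import Literature.NumberTheory.EllipticCurves.HasseWeilAbelianEulerFactorElliptic
import HarnessLib

/-!
# The closed Euler-factor schema `∀ K W ℓ, hasseWeilEulerFactor_geomPoints W ℓ` is false

`Proofs` file (theorems only, no definitions, no named facts) in topic
`NumberTheory/EllipticCurves`, sibling of `HasseWeilAbelian` (trunk EllArithM, item C15) and
`HasseWeilAbelianEulerFactorElliptic`; outcome of the cone-insurance statement audit of the named
fact `WeierstrassCurve.hasseWeilEulerFactor_geomPoints` (2026-08-15).

The named fact `WeierstrassCurve.hasseWeilEulerFactor_geomPoints W ℓ` of `HasseWeilAbelian`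
(*the `ℓ`-adic Euler factor `det(1 - σ_v T ∣ (V_ℓ W_ns(K̄))_{I_v})` at every `v ∤ ℓ` is Mathlib's
local polynomial `L_v(W, T)`*) carries the binders `{K} [Field K] (W) (ℓ) [Fact ℓ.Prime]
[NumberField K]` and **no** `[W.IsElliptic]` (the section instance of the sorried theorem it was
produced from is not picked up by a `Prop`-valued `def`), whereas its printed sources concern
elliptic curves / abelian varieties only: Serre–Tate (1968), §2 Thm. 3 (*"let `A` be an abelian
variety over `K` which has potential good reduction at `v` … The characteristic polynomial of
`ρ_l(σ)` has integral coefficients independent of `l`"*, *Œuvres* II PDF pp. 453–454); Serre,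
*Facteurs locaux* (1970), n° 2.4 (*"Supposons que `Y` soit une courbe elliptique … a)
`P(T) = 1 - a_v T + Nv T²`, b) `P(T) = 1 - c_v T`, `c_v = ±1`, c) `P = 1`"*, *Œuvres* II PDF
p. 556); Silverman, *AEC*, C.§16 (*"Let `E/K` be an elliptic curve"*, PDF p. 390).  Read as a
closed statement — the type of a would-be `hasseWeilEulerFactor_geomPoints_holds` — it is
**false**, and this file records the two closed negations:

* `WeierstrassCurve.not_forall_hasseWeilEulerFactor_geomPoints ℓ`: over **every** number field `K`
  and for **every** prime `ℓ`, `¬ ∀ W : WeierstrassCurve K, W.hasseWeilEulerFactor_geomPoints ℓ`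
  — witness any split nodal cubic `singularModel x₀ y₀ α₁ α₂`, `α₁ ≠ α₂`
  (`WeierstrassCurve.not_hasseWeilEulerFactor_geomPoints_singularModel`,
  `HasseWeilAbelianRationalEulerFactorsNodal`: its `geomPoints ≃ K̄ˣ` equivariantly, `V_ℓ = ℚ_ℓ(1)`
  has Euler factor `1 - (N v) T`, `N v ≥ 2`, at `v ∤ ℓ`, while Mathlib's `localPolynomial` of a
  `Δ = 0` equation lies in `{1 - T, 1 + T, 1}`);
* `WeierstrassCurve.not_hasseWeilEulerFactor_geomPoints`: the literal closure over
  `{K : Type} [Field K] (W) (ℓ) [Fact ℓ.Prime] [NumberField K]` is false (instance `K = ℚ`,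
  `ℓ = 2`); in particular no universe-polymorphic `_holds` theorem of the schema can exist.

The faithful statement is the corrected fact
`WeierstrassCurve.hasseWeilEulerFactor_geomPoints_of_isElliptic W ℓ`
(`HasseWeilAbelianEulerFactorElliptic`, `[W.IsElliptic]` quantified in the body), which is a
**theorem of the tree** (`WeierstrassCurve.hasseWeilEulerFactor_geomPoints_of_isElliptic_holds`,
`HasseWeilAbelianEulerFactorHoldsProofs`), whence the schema instance for elliptic `W`
(`WeierstrassCurve.hasseWeilEulerFactor_geomPoints_holds_of_isElliptic`) — the form every consumer
uses.

## References

* J. H. Silverman, *The Arithmetic of Elliptic Curves*, 2nd ed., GTM 106 (2009), Prop. III.2.5,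
  Exercise 3.5 (the split node `E_ns(K̄) ≃ K̄ˣ`), §C.16 (PDF p. 390, the local factors `L_v(T)` of
  an elliptic curve). [SilvermanAEC2009]
* J.-P. Serre, J. Tate, *Good reduction of abelian varieties*, Ann. of Math. 88 (1968), §1
  Lemma 2, §2 Thm. 3 (*Œuvres* II no. 79, PDF pp. 450, 454). [SerreTateAnnals1968] (interim key
  [SerreTate1968] in the sibling files)
* J.-P. Serre, *Facteurs locaux des fonctions zêta des variétés algébriques* (1970), n° 2.2 (13)
  (`P_ϱ(T) = det(1 - π_ϱ T)` on `V^I`, geometric Frobenius) and n° 2.4 (elliptic curves)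
  (*Œuvres* II no. 87, PDF pp. 554, 556); no `references.bib` key (cited in prose only).

## Design

Theorems only; no `noncomputable section` needed; one universe `u` (`K : Type u`) for the
per-field form, `K : Type` (universe `0`, witness `ℚ`) for the literal closure; deliberate
dot-notation extensions of Mathlib's `WeierstrassCurve` namespace, as in the sibling files.
-/

namespace WeierstrassCurve

open Literature.NumberTheory.EllipticCurves

universe u

section PerField

variable {K : Type u} [Field K] [NumberField K] (ℓ : ℕ) [Fact ℓ.Prime]

/-- **For every number field `K` and every prime `ℓ`, the Euler-factor schema over all
`W : WeierstrassCurve K` is false**: `¬ ∀ W, W.hasseWeilEulerFactor_geomPoints ℓ`, by the split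
nodal cubic `singularModel 0 0 0 1 : y² - xy = x³` (`exists_not_hasseWeilEulerFactor_geomPoints`,
from `not_hasseWeilEulerFactor_geomPoints_singularModel`: `V_ℓ(E_ns(K̄)) = ℚ_ℓ(1)` has factor
`1 - (N v) T` at `v ∤ ℓ`, never Mathlib's `1 - T`, `1 + T`, `1` for a `Δ = 0` equation).  Hence
`WeierstrassCurve.hasseWeilEulerFactor_geomPoints` admits no `_holds` theorem at any `K`, `ℓ`; the
statement to use is `hasseWeilEulerFactor_geomPoints_of_isElliptic` (proved:
`hasseWeilEulerFactor_geomPoints_of_isElliptic_holds`).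
[cite: SilvermanAEC2009, Prop. III.2.5, Exercise 3.5 and §C.16 (PDF p. 390)] -/
theorem not_forall_hasseWeilEulerFactor_geomPoints :
    ¬ ∀ W : WeierstrassCurve K, W.hasseWeilEulerFactor_geomPoints ℓ := fun H ↦
  (exists_not_hasseWeilEulerFactor_geomPoints (K := K) ℓ).elim fun W' hW' ↦ hW' (H W')

end PerField

/-- **The closed schema is false.**  The literal closure of the named fact
`WeierstrassCurve.hasseWeilEulerFactor_geomPoints` over its binders
`{K : Type} [Field K] (W : WeierstrassCurve K) (ℓ : ℕ) [Fact ℓ.Prime] [NumberField K]` — the type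
of a would-be `hasseWeilEulerFactor_geomPoints_holds` at universe `0` — fails at `K = ℚ`, `ℓ = 2`
and a split nodal cubic (`not_forall_hasseWeilEulerFactor_geomPoints`).  The printed theorem
(Serre–Tate 1968, Thm. 3; Serre 1970, n° 2.4; Silverman, *AEC*, C.§16) concerns elliptic curves
and is the tree's theorem `hasseWeilEulerFactor_geomPoints_of_isElliptic_holds`.
[cite: SilvermanAEC2009, Prop. III.2.5, Exercise 3.5 and §C.16 (PDF p. 390)]
[cite: SerreTateAnnals1968, §2 Thm. 3 (Œuvres II no. 79, PDF p. 454)] -/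
theorem not_hasseWeilEulerFactor_geomPoints :
    ¬ ∀ {K : Type} [Field K] (W : WeierstrassCurve K) (ℓ : ℕ) [Fact ℓ.Prime] [NumberField K],
        W.hasseWeilEulerFactor_geomPoints ℓ := fun H ↦
  haveI : Fact (Nat.Prime 2) := ⟨Nat.prime_two⟩
  not_forall_hasseWeilEulerFactor_geomPoints (K := ℚ) 2 fun W ↦ H W 2

end WeierstrassCurve
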